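import Summits.QuantumFields.YangMills.Theorems.BalabanUVNodesN16AtRRec11
import HarnessLib

/-!
# Route «BalabanUVNodes», cluster K4 «SpineRates» — node N16 = NE3 AT ANY KEYED RATE HOME (stage-generic): the K4 stub `S_N16 RRec` for every home `RRec`
# that pins, at a datum key `key F D` of ANY stage, the NE3 literal `ne3OfRecord₁₁ F (ne3At h g₀ os k)` of a key-indexed NE3 reading `ne3At` — knit, `iff`,
# N21's face, θ-form transfer and the junk tests ONCE; the Stage-11 home `RRec₁₁ 𝔯` (p457330) is an instance (`admits_rRec₁₁` ∕ `attains_rRec₁₁`), the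
# Stage-12 home `RRec₁₂ 𝔯` (dag-n22-e g2, `…RateCarriersOfRecord12`) the next one — so a record re-key costs N16 two 3-line certificates, not a module

Cell `pub-ymgap`, seat `pub-ymgap-dag-n16-e` (R134 acceleration seat (a), strategy s2 = BY-NAME KNIT at the record; HUMAN RULING D-0062; chair R424 venue),
generation 2, file 5 (THEOREMS ONLY, 0 `def`, 0 `sorry`).  `bears_on: R4∕N16 · K3 SpineGivenEndpointR11 (→ its Stage-12 successor)`.  Filed `--supports
stmt-QuantumFields-19676`.  Imports this seat's file 4 `BalabanUVNodesN16AtRRec11` (p457574; through it files 1–3 p455532∕p455642∕p456710: `PrintSlot`,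
`InEndRegime`, `radiusOfRecord`, `constOfRecord`, `n16At_of_inEndRegime_printSlot`, the stage-free faces `n16At_ne3Objects_flatDom` ∕ `not_n16At_ne3Objects_negLip`
at the NE3 literal, and layer B `BalabanUVNodesRateCarriersOfRecord11` p457330: `ne3OfRecord₁₁`, `RateReading₁₁`, `rateCarriersOfRecord₁₁`, `RRec₁₁`).  Restates nothing.

WHY (pub-ymgap INBOX l.12862 ∕ l.13002 ∕ l.13054, 2026-08-26).  node00-def-T LOCATED-2: `Stage11Params.Provisos₁₁` is uninhabited (`Node00.not_provisos₁₁`,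
`Node00.not_isRecordOfRecord₁₁C`, `Node00/Record12.lean`), so the Stage-11 datum key `IsDatumOfRecord₁₁C` is EMPTY and every K4 stub at the Stage-11 home
`RRec₁₁ 𝔯` — among them this seat's `N16AtRRec11.s_N16_rRec₁₁_of_inEndRegime_printSlot` — holds with no estimate (dag-n22-e g2 `k4_rRec₁₁_outright`);
content re-keys to Stage 12 (`Node00/Record12DatumKey.lean`, node00-def-RR-2 g2; layer B `RRec₁₂`, dag-n22-e g2), and the record has already moved
₉ → ₁₀ → ₁₁ → ₁₂ in two days.  N16's side of a rate home depends on exactly TWO data: WHICH datum key the home quantifies over, and WHICH NE3 object of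
RR-1's stage-free container `Node00.NE3Objects₁₁ N` the home's reading assigns at a key, couplings `g₀`, loop string `os` and run length `k`.  This file
therefore states N16's home theorems over
* an arbitrary KEY `key : (F : T4Family) → Datum F N → Prop` (`IsDatumOfRecord₁₁C`, `IsDatumOfRecord₁₂C`, …),
* an arbitrary KEY-INDEXED NE3 READING `ne3At : key F D → (ℕ → ℝ) → List (ULoop F) → ℕ → NE3Objects₁₁ N` (at ₁₁: `(𝔯.lit F h.params g₀ os).ne3 k`; at ₁₂:
  `(𝔯.lit F h.params h.provisos g₀ os).ne3 k` — proof-irrelevance makes the choice of `h` immaterial),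
* an arbitrary home `RRec : RateRecordPred N` that ADMITS only the reading's literals (`hadm`: every pinned bundle's `R.ne3` is `ne3OfRecord₁₁ F (ne3At h g₀ os k)`
  for some key proof `h` and run length `k`) and, for the converse directions, ATTAINS them (`hatt`: every `(h, g₀, os, k)` is pinned by some bundle) — both are
  ONE-LINE facts for a home of layer B's shape `fun F D g₀ os R => ∃ (h : key F D) k, R = carriers … h … g₀ os k` (§5 certifies them for `RRec₁₁ 𝔯`).

CONTENT.
§1 `s_N16_of_admits` (N16 at every literal ⇒ `S_N16 RRec`), `s_N16_iff_of_admits_attains` (`S_N16 RRec` IS «N16 at every key and run length»).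
§2 THE KNIT, once: `s_N16_of_admits_inEndRegime_printSlot` (`InEndRegime` ∧ `PrintSlot` at every literal ⇒ `S_N16 RRec`, file 1's closer) and its θ-FORM
   `s_N16_of_admits_forall_params` (the reading factors through a parameter map `par : key F D → Θ F` landing in a «good» set — admissible-with-provisos — and the
   prover discharges proviso + slot at EVERY good parameter; no canonical parameter in sight).
§3 N21's FACE, once: `covRoot_of_attains` (under `S_N16 RRec`, the covariant root `NE3EnergyRateWCov 4 (sfClass 4 L o.Nper o.ε) L o.Nper o.b o.g o.C o.Λ₁ o.Λ₂' o.dom`,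
   `L = ne3LOfRecord₁₁ F`, at every `o = ne3At h g₀ os k`).
§4 THE JUNK TESTS, once [decided toys]: `s_N16_of_admits_flat` (a reading with flat NE3 data closes the stub with no content), `not_s_N16_of_pins_negLip` (a home
   pinning ONE bundle whose NE3 component is a `Λ₁ = −1` flat literal has `¬ S_N16 RRec` — key-free), `exists_ne3At_const` (every key type carries the constant
   reading at any prescribed `o`).
§5 THE STAGE-11 INSTANCE CERTIFICATES: `admits_rRec₁₁`, `attains_rRec₁₁` (layer B's `RRec₁₁ 𝔯` with `key := IsDatumOfRecord₁₁C`,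
   `ne3At h g₀ os k := (𝔯.lit F h.params g₀ os).ne3 k`; with them §2 applied to `RRec₁₁ 𝔯` is literally file 4's `N16AtRRec11.s_N16_rRec₁₁_of_inEndRegime_printSlot`
   — not restated; located-vacuous at ₁₁ per LOCATED-2; the ₁₂ certificates are the two 3-line theorems of this seat's file 6 once `RRec₁₂` lands).
§6 (v1.1, APPEND-ONLY) `inEndRegime_ne3OfRecord₁₁_canonical` (the thresholds of record THEMSELVES satisfy the proviso: `⟨Nper, r, r∕2, g, Cof, r, Λ₂', dom⟩`,
   `r = radiusOfRecord N F.L Nper`, `Cof = constOfRecord N F.L Nper g`, any `Nper ≥ 1`, `g > 0`), `exists_inEndRegime_ne3OfRecord₁₁` (non-vacuity of the proviso at every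
   family), `s_N16_of_admits_canonical_printSlot` (a reading pinned at the canonical letters owes `PrintSlot` and the `dom` pin ONLY).

HONEST FRAMING.  Kernel bookkeeping by name, stage-generic; no estimate; `InEndRegime` (THE END's thresholds) and `PrintSlot` ([Balaban1985RegularSpaces] Theorem 4
in the all-torus geometry at the record's pairs — N05's — and [Balaban1985Variational] Thm 1 (8)+(10) `LeafH3sup` — N07's) remain HYPOTHESES, proved nowhere in
the tree; every reading is UNPINNED; no datum key of any stage is claimed inhabited (K0 ∕ K0′); **N16 ∕ NE3 is NOT discharged**; count-neutral; one finite
four-torus at fixed ε — NOT ℝ⁴, NOT infinite volume, NOT OS, NOT a mass gap, NOT Clay.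
-/

set_option autoImplicit false

open scoped BigOperators Matrix Matrix.Norms.L2Operator
open NormedSpace

namespace Summit.QuantumFields.YangMills.BalabanUVNodes.N16AtKeyedHome

open Literature.MathematicalPhysics.QuantumFieldTheory.Balaban1983to89
open Literature.MathematicalPhysics.QuantumFieldTheory.Balaban1983to89.T4Continuum (T4Family ULoop FiniteEpsData)
open B7Prop1Explicit B7Prop2Explicit
open T4AveragingDeficitWallBoundary (IsPeriodicCfg)
open Node00 (IsDatumOfRecord₁₁C Stage11Params NE3Objects₁₁ RateObjects₁₁ ne3LOfRecord₁₁ nonempty_rateObjects₁₁)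
open Summit.QuantumFields.BalabanUV.T4Continuum
open MinimalActionRate (sfClass)
open MinimalActionRefine (gradConst)
open MinimalActionWitness (flatCfg)
open NE3EnergyShapes (IsUnitarySite)
open NE3EnergyWeightedCovShape (NE3EnergyRateWCov)
open YMDAG.UVSplit (Datum NE3Carriers RateCarriers RateRecordPred N16At S_N16 ne3OfRecord₁₁ RateReading₁₁ rateCarriersOfRecord₁₁ RRec₁₁)
open Summit.QuantumFields.YangMills.BalabanUVNodes.N16Regime (PrintSlot InEndRegime n16At_of_inEndRegime_printSlot)
open Summit.QuantumFields.YangMills.BalabanUVNodes.N16AtRateRecord11 (n16At_ne3Objects_flatDom not_n16At_ne3Objects_negLip)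

noncomputable section

variable {N : ℕ} [NeZero N]

section KeyedHome

variable {key : (F : T4Family) → Datum F N → Prop}
  (ne3At : ∀ {F : T4Family} {D : Datum F N}, key F D → (ℕ → ℝ) → List (ULoop F) → ℕ → NE3Objects₁₁ N)
  (RRec : RateRecordPred N)

/-! ## §1 `S_N16` at a home admitting ∕ attaining the literals of a key-indexed NE3 reading -/

/-- **N16 AT EVERY LITERAL GIVES THE STUB**: if the home admits only bundles whose NE3 component is the literal `ne3OfRecord₁₁ F (ne3At h g₀ os k)` of the reading at
some key proof and run length (`hadm`), and N16 holds at every such literal, then `S_N16 RRec`. [folklore] -/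
theorem s_N16_of_admits
    (hadm : ∀ (F : T4Family) (D : Datum F N) (g₀ : ℕ → ℝ) (os : List (ULoop F)) (R : RateCarriers N), RRec F D g₀ os R →
      ∃ (h : key F D) (k : ℕ), R.ne3 = ne3OfRecord₁₁ F (ne3At h g₀ os k))
    (h16 : ∀ (F : T4Family) (D : Datum F N) (h : key F D) (g₀ : ℕ → ℝ) (os : List (ULoop F)) (k : ℕ), N16At (ne3OfRecord₁₁ F (ne3At h g₀ os k))) :
    S_N16 RRec := by
  intro F D g₀ os R hR
  obtain ⟨h, k, hne3⟩ := hadm F D g₀ os R hR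
  rw [hne3]
  exact h16 F D h g₀ os k

/-- **`S_N16 RRec` IS «N16 AT EVERY KEY AND RUN LENGTH»** for a home that admits (`hadm`) and attains (`hatt`) exactly the reading's literals. [folklore] -/
theorem s_N16_iff_of_admits_attains
    (hadm : ∀ (F : T4Family) (D : Datum F N) (g₀ : ℕ → ℝ) (os : List (ULoop F)) (R : RateCarriers N), RRec F D g₀ os R →
      ∃ (h : key F D) (k : ℕ), R.ne3 = ne3OfRecord₁₁ F (ne3At h g₀ os k))
    (hatt : ∀ (F : T4Family) (D : Datum F N) (h : key F D) (g₀ : ℕ → ℝ) (os : List (ULoop F)) (k : ℕ),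
      ∃ R : RateCarriers N, RRec F D g₀ os R ∧ R.ne3 = ne3OfRecord₁₁ F (ne3At h g₀ os k)) :
    S_N16 RRec ↔
      ∀ (F : T4Family) (D : Datum F N) (h : key F D) (g₀ : ℕ → ℝ) (os : List (ULoop F)) (k : ℕ), N16At (ne3OfRecord₁₁ F (ne3At h g₀ os k)) := by
  refine ⟨fun hS F D h g₀ os k => ?_, s_N16_of_admits ne3At RRec hadm⟩
  obtain ⟨R, hR, hne3⟩ := hatt F D h g₀ os k
  have h16 := hS F D g₀ os R hR
  rwa [hne3] at h16

/-! ## §2 The knit and its θ-form, once -/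

/-- **THE KNIT AT ANY KEYED HOME** — `S_N16 RRec` from the proviso `InEndRegime` (the pin's display: THE END's thresholds) and the print-form slot `PrintSlot` (the
pin's content: N05's Theorem 4 at the bundle's pairs + N07's `LeafH3sup`) at every literal of the reading; one application of file 1's closer
`n16At_of_inEndRegime_printSlot`.  Neither hypothesis is asserted here. [folklore] -/
theorem s_N16_of_admits_inEndRegime_printSlot
    (hadm : ∀ (F : T4Family) (D : Datum F N) (g₀ : ℕ → ℝ) (os : List (ULoop F)) (R : RateCarriers N), RRec F D g₀ os R →
      ∃ (h : key F D) (k : ℕ), R.ne3 = ne3OfRecord₁₁ F (ne3At h g₀ os k))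
    (h : ∀ (F : T4Family) (D : Datum F N) (h : key F D) (g₀ : ℕ → ℝ) (os : List (ULoop F)) (k : ℕ),
      InEndRegime (ne3OfRecord₁₁ F (ne3At h g₀ os k)) ∧ PrintSlot (ne3OfRecord₁₁ F (ne3At h g₀ os k))) :
    S_N16 RRec :=
  s_N16_of_admits ne3At RRec hadm fun F D hk g₀ os k => n16At_of_inEndRegime_printSlot (h F D hk g₀ os k).1 (h F D hk g₀ os k).2

/-- **THE θ-FORM OF THE KNIT AT ANY KEYED HOME** — what a prover of the pin discharges, with no canonical parameter in sight.  Suppose the key-indexed reading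
FACTORS through a parameter map: `ne3At h g₀ os k = ρ F (par h) g₀ os k` for a stage's parameter type `Θ F` (at ₁₁: `Stage11Params F N`, `par h = h.params`; at ₁₂:
the admissible-with-provisos pairs `(θ, hP)`, `par h = ⟨h.params, h.provisos⟩`), and every key's parameter is GOOD (`good F (par h)`: admissible with provisos —
RR-2's `.admissible` ∕ `.provisos`).  If the proviso and the slot hold at the reading `ρ` for EVERY good parameter along every `(g₀, os, k)`, then `S_N16 RRec`. [folklore] -/
theorem s_N16_of_admits_forall_params {Θ : T4Family → Type*} (ρ : (F : T4Family) → Θ F → (ℕ → ℝ) → List (ULoop F) → ℕ → NE3Objects₁₁ N)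
    (good : (F : T4Family) → Θ F → Prop) (par : ∀ {F : T4Family} {D : Datum F N}, key F D → Θ F)
    (hpar : ∀ (F : T4Family) (D : Datum F N) (h : key F D), good F (par h))
    (hfac : ∀ (F : T4Family) (D : Datum F N) (h : key F D) (g₀ : ℕ → ℝ) (os : List (ULoop F)) (k : ℕ), ne3At h g₀ os k = ρ F (par h) g₀ os k)
    (hadm : ∀ (F : T4Family) (D : Datum F N) (g₀ : ℕ → ℝ) (os : List (ULoop F)) (R : RateCarriers N), RRec F D g₀ os R →
      ∃ (h : key F D) (k : ℕ), R.ne3 = ne3OfRecord₁₁ F (ne3At h g₀ os k))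
    (h : ∀ (F : T4Family) (θ : Θ F), good F θ → ∀ (g₀ : ℕ → ℝ) (os : List (ULoop F)) (k : ℕ),
      InEndRegime (ne3OfRecord₁₁ F (ρ F θ g₀ os k)) ∧ PrintSlot (ne3OfRecord₁₁ F (ρ F θ g₀ os k))) :
    S_N16 RRec :=
  s_N16_of_admits_inEndRegime_printSlot ne3At RRec hadm fun F D hk g₀ os k => by
    rw [hfac F D hk g₀ os k]
    exact h F (par hk) (hpar F D hk) g₀ os k

/-! ## §3 N21's face, once -/

/-- **N21's FACE AT ANY KEYED HOME** — under `S_N16 RRec`, at every key, `(g₀, os)` and run length the covariant root holds at the reading's NE3 object with the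
family's block factor (`…N21ClosenessAtRecord`'s `hcov`; requires the home to ATTAIN the literal). [folklore] -/
theorem covRoot_of_attains
    (hatt : ∀ (F : T4Family) (D : Datum F N) (h : key F D) (g₀ : ℕ → ℝ) (os : List (ULoop F)) (k : ℕ),
      ∃ R : RateCarriers N, RRec F D g₀ os R ∧ R.ne3 = ne3OfRecord₁₁ F (ne3At h g₀ os k))
    (hS : S_N16 RRec) (F : T4Family) (D : Datum F N) (h : key F D) (g₀ : ℕ → ℝ) (os : List (ULoop F)) (k : ℕ) :
    NE3EnergyRateWCov 4 (sfClass 4 (ne3LOfRecord₁₁ F) (ne3At h g₀ os k).Nper (ne3At h g₀ os k).ε) (ne3LOfRecord₁₁ F) (ne3At h g₀ os k).Nper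
      (ne3At h g₀ os k).b (ne3At h g₀ os k).g (ne3At h g₀ os k).C (ne3At h g₀ os k).Λ₁ (ne3At h g₀ os k).Λ₂' (ne3At h g₀ os k).dom := by
  obtain ⟨R, hR, hne3⟩ := hatt F D h g₀ os k
  have h16 := hS F D g₀ os R hR
  rw [hne3] at h16
  exact h16

/-! ## §4 The junk tests, once: the pin of the reading decides -/

/-- **A READING WITH FLAT NE3 DATA CLOSES THE STUB — CONTENT-FREE** [decided toy]: if every NE3 object the reading assigns (all keys, couplings, loop strings, run
lengths) has period `≥ 1`, non-negative `ε, C, Λ₁, Λ₂'` and the flat stratum of its period as data, then `S_N16 RRec` by n16-a's `n16At_flatStratum` — no slot, no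
estimate.  So the `dom` pin is where N16's content enters ANY home. [folklore] -/
theorem s_N16_of_admits_flat
    (hadm : ∀ (F : T4Family) (D : Datum F N) (g₀ : ℕ → ℝ) (os : List (ULoop F)) (R : RateCarriers N), RRec F D g₀ os R →
      ∃ (h : key F D) (k : ℕ), R.ne3 = ne3OfRecord₁₁ F (ne3At h g₀ os k))
    (hflat : ∀ (F : T4Family) (D : Datum F N) (h : key F D) (g₀ : ℕ → ℝ) (os : List (ULoop F)) (k : ℕ),
      1 ≤ (ne3At h g₀ os k).Nper ∧ 0 ≤ (ne3At h g₀ os k).ε ∧ 0 ≤ (ne3At h g₀ os k).C ∧ 0 ≤ (ne3At h g₀ os k).Λ₁ ∧ 0 ≤ (ne3At h g₀ os k).Λ₂' ∧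
        (ne3At h g₀ os k).dom = {v : Site 4 → Fin 4 → (Matrix (Fin N) (Fin N) ℂ)ˣ | IsPeriodicCfg v ((ne3At h g₀ os k).Nper : ℤ) ∧
          ∃ w : Site 4 → (Matrix (Fin N) (Fin N) ℂ)ˣ, IsUnitarySite w ∧ v = gaugeAct w flatCfg}) :
    S_N16 RRec :=
  s_N16_of_admits ne3At RRec hadm fun F D hk g₀ os k => by
    obtain ⟨hN, hε, hC, hΛ₁, hΛ₂', hdom⟩ := hflat F D hk g₀ os k
    exact n16At_ne3Objects_flatDom F _ hN hε hC hΛ₁ hΛ₂' hdom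

end KeyedHome

/-- **A HOME PINNING ONE NEGATIVE-LIPSCHITZ FLAT LITERAL HAS NO `S_N16`** [decided toy] (key-free): if SOME pinned bundle's NE3 component is the literal of an object
with `Λ₁ = −1`, `g = gradConst 4 c′`, `ε, b, c′ ≥ 0` and flat data, the stub FAILS (file 2's refuting carrier) — letters left free in a reading are refuted wherever
the home attains them; the pin owes `InEndRegime`. [folklore] -/
theorem not_s_N16_of_pins_negLip (RRec : RateRecordPred N) {F : T4Family} {D : Datum F N} {g₀ : ℕ → ℝ} {os : List (ULoop F)} {R : RateCarriers N}
    (hR : RRec F D g₀ os R) (o : NE3Objects₁₁ N) (hne3 : R.ne3 = ne3OfRecord₁₁ F o) {c' : ℝ} (hε : 0 ≤ o.ε) (hb : 0 ≤ o.b) (hc' : 0 ≤ c')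
    (hg : o.g = gradConst 4 c') (hΛ₁ : o.Λ₁ = -1)
    (hdom : o.dom = {v : Site 4 → Fin 4 → (Matrix (Fin N) (Fin N) ℂ)ˣ | IsPeriodicCfg v (o.Nper : ℤ) ∧
      ∃ w : Site 4 → (Matrix (Fin N) (Fin N) ℂ)ˣ, IsUnitarySite w ∧ v = gaugeAct w flatCfg}) :
    ¬ S_N16 RRec := fun hS => by
  have h16 := hS F D g₀ os R hR
  rw [hne3] at h16
  exact not_n16At_ne3Objects_negLip F o hε hb hc' hg hΛ₁ hdom h16

/-- **EVERY KEY TYPE CARRIES THE CONSTANT READING** at any prescribed NE3 objects `o` (so both junk tests bite at every stage's home of layer B's shape). [folklore] -/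
theorem exists_ne3At_const {key : (F : T4Family) → Datum F N → Prop} (o : NE3Objects₁₁ N) :
    ∃ ne3At : ∀ {F : T4Family} {D : Datum F N}, key F D → (ℕ → ℝ) → List (ULoop F) → ℕ → NE3Objects₁₁ N,
      ∀ (F : T4Family) (D : Datum F N) (h : key F D) (g₀ : ℕ → ℝ) (os : List (ULoop F)) (k : ℕ), ne3At h g₀ os k = o :=
  ⟨fun _ _ _ _ => o, fun _ _ _ _ _ _ => rfl⟩

/-! ## §5 The Stage-11 instance certificates (layer B's `RRec₁₁ 𝔯`; located-vacuous at ₁₁ per LOCATED-2, kept as the pattern the Stage-12 instance follows) -/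

/-- **`RRec₁₁ 𝔯` ADMITS only the literals of its reading** (`key := IsDatumOfRecord₁₁C`, `ne3At h g₀ os k := (𝔯.lit F h.params g₀ os).ne3 k`; `rfl` on the bundle's
third component). [folklore] -/
theorem admits_rRec₁₁ (𝔯 : RateReading₁₁ N) (F : T4Family) (D : Datum F N) (g₀ : ℕ → ℝ) (os : List (ULoop F)) (R : RateCarriers N)
    (hR : RRec₁₁ 𝔯 F D g₀ os R) :
    ∃ (h : IsDatumOfRecord₁₁C F N D) (k : ℕ), R.ne3 = ne3OfRecord₁₁ F ((𝔯.lit F h.params g₀ os).ne3 k) := by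
  obtain ⟨h, k, rfl⟩ := hR
  exact ⟨h, k, rfl⟩

/-- **`RRec₁₁ 𝔯` ATTAINS every literal of its reading** (witness: the run-length-`k` bundle `rateCarriersOfRecord₁₁ 𝔯 F h.params g₀ os k`, layer B's `rRec₁₁_self`).
[folklore] -/
theorem attains_rRec₁₁ (𝔯 : RateReading₁₁ N) (F : T4Family) (D : Datum F N) (h : IsDatumOfRecord₁₁C F N D) (g₀ : ℕ → ℝ) (os : List (ULoop F)) (k : ℕ) :
    ∃ R : RateCarriers N, RRec₁₁ 𝔯 F D g₀ os R ∧ R.ne3 = ne3OfRecord₁₁ F ((𝔯.lit F h.params g₀ os).ne3 k) :=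
  ⟨rateCarriersOfRecord₁₁ 𝔯 F h.params g₀ os k, ⟨h, k, rfl⟩, rfl⟩

/-! ## §6 (v1.1, APPEND-ONLY) THE THRESHOLDS OF RECORD THEMSELVES SATISFY THE PROVISO — the regime is non-empty at every `(F, Nper ≥ 1, g > 0)`, and a
reading pinned AT THE CANONICAL LETTERS owes `PrintSlot` and the `dom` pin ONLY -/

open Summit.QuantumFields.YangMills.BalabanUVNodes.N16Regime (radiusOfRecord constOfRecord radiusOfRecord_pos)
open Summit.QuantumFields.YangMills.BalabanUVNodes.N16AtRateRecord11 (inEndRegime_ne3Objects_iff)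

/-- **THE CANONICAL LETTERS OF RECORD SATISFY `InEndRegime`**: at any family `F`, period `Nper ≥ 1`, coupling letter `g > 0`, any `Λ₂'` and any data `dom`, the
NE3 objects `⟨Nper, r, r∕2, g, Cof, r, Λ₂', dom⟩` with `r = radiusOfRecord N F.L Nper` (class radius AND Hölder letter AT the threshold, regularity `b = r∕2`) and
`Cof = constOfRecord N F.L Nper g` (constant AT the threshold) lie in THE END's regime — `radiusOfRecord_pos` (file 1) and `2 ≤ F.L` (`HistoryFlow.two_le_L`).  So a
definer's pin of `𝔯.lit · ne3` can DISCHARGE the proviso by choosing these letters; what it then owes is `PrintSlot` and the `dom` pin. [folklore] -/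
theorem inEndRegime_ne3OfRecord₁₁_canonical (F : T4Family) {Nper : ℕ} (hN : 1 ≤ Nper) {g : ℝ} (hg : 0 < g) (Λ₂' : ℝ)
    (dom : Set (Site 4 → Fin 4 → (Matrix (Fin N) (Fin N) ℂ)ˣ)) :
    InEndRegime (ne3OfRecord₁₁ F ⟨Nper, radiusOfRecord N F.L Nper, radiusOfRecord N F.L Nper / 2, g, constOfRecord N F.L Nper g,
      radiusOfRecord N F.L Nper, Λ₂', dom⟩) := by
  have hr : 0 < radiusOfRecord N F.L Nper := radiusOfRecord_pos (HistoryFlow.two_le_L F) hN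
  refine (inEndRegime_ne3Objects_iff F _).2 ⟨hN, hg, hr, le_rfl, hr.le, le_rfl, ?_, le_rfl, le_rfl⟩
  change (0 : ℝ) ≤ radiusOfRecord N F.L Nper / 2
  positivity

/-- **THE PROVISO IS NON-VACUOUS AT EVERY FAMILY**: some NE3 objects satisfy `InEndRegime` at `F` (witness: the canonical letters at `Nper = 1`, `g = 1`, `Λ₂' = 0`,
`dom = ∅`). [folklore] -/
theorem exists_inEndRegime_ne3OfRecord₁₁ (F : T4Family) : ∃ o : NE3Objects₁₁ N, InEndRegime (ne3OfRecord₁₁ F o) :=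
  ⟨_, inEndRegime_ne3OfRecord₁₁_canonical F le_rfl one_pos 0 ∅⟩

/-- **A READING PINNED AT THE CANONICAL LETTERS OWES `PrintSlot` ONLY** (any keyed home): if the home admits only the literals of a key-indexed reading (`hadm`) whose
every object carries the canonical letters of record — `⟨Nper, r, r∕2, g, Cof, r, Λ₂', dom⟩` for SOME `Nper ≥ 1`, `g > 0`, `Λ₂'`, `dom` depending on the key and the run
(`hcanon`) — then `PrintSlot` at every literal ALONE gives `S_N16 RRec` (§2's knit with the proviso discharged by `inEndRegime_ne3OfRecord₁₁_canonical`). [folklore] -/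
theorem s_N16_of_admits_canonical_printSlot {key : (F : T4Family) → Datum F N → Prop}
    (ne3At : ∀ {F : T4Family} {D : Datum F N}, key F D → (ℕ → ℝ) → List (ULoop F) → ℕ → NE3Objects₁₁ N) (RRec : RateRecordPred N)
    (hadm : ∀ (F : T4Family) (D : Datum F N) (g₀ : ℕ → ℝ) (os : List (ULoop F)) (R : RateCarriers N), RRec F D g₀ os R →
      ∃ (h : key F D) (k : ℕ), R.ne3 = ne3OfRecord₁₁ F (ne3At h g₀ os k))
    (hcanon : ∀ (F : T4Family) (D : Datum F N) (h : key F D) (g₀ : ℕ → ℝ) (os : List (ULoop F)) (k : ℕ),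
      ∃ (Nper : ℕ) (g Λ₂' : ℝ) (dom : Set (Site 4 → Fin 4 → (Matrix (Fin N) (Fin N) ℂ)ˣ)), 1 ≤ Nper ∧ 0 < g ∧
        ne3At h g₀ os k = ⟨Nper, radiusOfRecord N F.L Nper, radiusOfRecord N F.L Nper / 2, g, constOfRecord N F.L Nper g, radiusOfRecord N F.L Nper, Λ₂', dom⟩)
    (hslot : ∀ (F : T4Family) (D : Datum F N) (h : key F D) (g₀ : ℕ → ℝ) (os : List (ULoop F)) (k : ℕ), PrintSlot (ne3OfRecord₁₁ F (ne3At h g₀ os k))) :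
    S_N16 RRec :=
  s_N16_of_admits_inEndRegime_printSlot ne3At RRec hadm fun F D hk g₀ os k => by
    refine ⟨?_, hslot F D hk g₀ os k⟩
    obtain ⟨Nper, g, Λ₂', dom, hN, hg, he⟩ := hcanon F D hk g₀ os k
    rw [he]
    exact inEndRegime_ne3OfRecord₁₁_canonical F hN hg Λ₂' dom

end

end Summit.QuantumFields.YangMills.BalabanUVNodes.N16AtKeyedHome
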